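import Summits.QuantumFields.YangMills.Theorems.UnitScaleTiltProp7LatticeBoxPotentialAlgebra
import HarnessLib

/-!
# LANE II (T2) — THE BOUNDARY-LAYER TRACE ROW ON A BOX (covariant small-bond form, ℤᵈ letters)

Item stmt-QuantumFields-19200 (`MinimiserStabilityRegPr`), LANE II «divergence recovery at curved `W`»; px4 g7 second read of ★p1 g19's PLAN (B7) ∕
(B7-BUDGET) v2.1, requirement (T): the constant part of the block averages of the local potential `φ_i` on a NON-tiled patch is a boundary-LAYER sum,
and the budget's row h7∕h8 stands verbatim once the layer mass is `O(t∕R)·mass + O(tR)·gradient energy` (this file).  Pen px4 g7 (§4 box bricks).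

* §1 (one line) `norm_sub_le_variation`, ★`line_layer_sq_le`: for `f : ℤ → E` on `[a, b]` and `t ∈ ℕ`,
  `Σ_{s∈[a,b], s<a+t ∨ b−t<s} ‖f s‖² ≤ (4t∕(b+1−a))·Σ_{[a,b]}‖f‖² + 4t(b+1−a)·Σ_{s∈[a,b], s<b}‖f(s+1) − f s‖²`.
* §2 (the box, flat) ★`sum_layer_sq_le`: `Σ_{Q_R ∖ Q_{R−t}}‖w‖² ≤ (4dt∕(2R+1))·Σ_{Q_R}‖w‖² + 4t(2R+1)·Σ_{Q_R}Σ_μ[x+e_μ∈Q_R]‖w(x+e_μ) − w x‖²` (Fubini in one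
  coordinate, lit ✓`sum_box_eq_sum_update`, + a union bound over the `2d` faces).
* §3 (covariant) ★★`sum_layer_sq_le_cov` (small-bond transporters `‖T − 1‖ ≤ β`: flat differences → covariant differences + `8dβ²·mass`) and
  ★★`sum_layer_sq_le_plaq` (the same from `PlaqSmall V (z−R) (z+R) α` in the box axial gauge, for `φ` and `∇_Vφ` directly; `β = 2dRα`).
Rung R3 brick; nothing about the YM gap is claimed.
-/

open scoped BigOperators Matrix.Norms.L2Operator
open Finset

namespace Summit.QuantumFields.YangMills.Theorems.Prop7LatticeBoxLayerTrace

open Literature.MathematicalPhysics.QuantumFieldTheory.Balaban1983to89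
open Literature.MathematicalPhysics.QuantumFieldTheory.Balaban1983to89.B4Eq19LatticeOperators
open B7Prop1Explicit (U1 gaugeAct axialFn gaugeAct_mem)
open B7Prop2Explicit (unitaryUnits)
open B7Eq78Linearization (conjR conjR_apply conjR_sub)
open B8Ineq132 (norm_conjR)
open Summit.QuantumFields.YangMills.Theorems.Prop7LatticeBoxFriedrichsCov (norm_conjR_sub_self_le sum_box_shift_le)
open Summit.QuantumFields.YangMills.Theorems.Prop7LatticeBoxPotentialAlgebra (mem_U1_of_mem_unitaryUnits)

variable {d N : ℕ} {E : Type*} [SeminormedAddCommGroup E]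

/-! ## §1 One line -/

/-- Telescoping on a line: for `s₀ ≤ k`, `‖f k − f s₀‖ ≤ Σ_{m∈[a,b], m<b}‖f(m+1) − f m‖` whenever `a ≤ s₀` and `k ≤ b`. [folklore] -/
theorem norm_sub_le_variation_of_le (f : ℤ → E) {a b s₀ k : ℤ} (ha : a ≤ s₀) (hsk : s₀ ≤ k) (hkb : k ≤ b) :
    ‖f k - f s₀‖ ≤ ∑ m ∈ Finset.Icc a b, (if m < b then ‖f (m + 1) - f m‖ else 0) := by
  obtain ⟨n, hn⟩ : ∃ n : ℕ, k = s₀ + n := ⟨(k - s₀).toNat, by rw [Int.toNat_of_nonneg (by linarith)]; ring⟩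
  subst hn
  have htel : f (s₀ + n) - f s₀ = ∑ i ∈ Finset.range n, (f (s₀ + (i + 1 : ℕ)) - f (s₀ + (i : ℕ))) := by
    rw [Finset.sum_range_sub (fun i : ℕ => f (s₀ + (i : ℕ)))]; simp
  rw [htel]
  refine (norm_sum_le _ _).trans ?_
  -- re-index `i ↦ s₀ + i` into `[a, b]`
  let emb : ℕ ↪ ℤ := ⟨fun i => s₀ + i, fun i j h => by simpa using h⟩
  have hsub : (Finset.range n).map emb ⊆ Finset.Icc a b := by
    intro m hm
    rw [Finset.mem_map] at hm
    obtain ⟨i, hi, rfl⟩ := hm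
    rw [Finset.mem_range] at hi
    simp only [emb, Function.Embedding.coeFn_mk, Finset.mem_Icc]
    constructor <;> omega
  have hre : ∑ i ∈ Finset.range n, ‖f (s₀ + (i + 1 : ℕ)) - f (s₀ + (i : ℕ))‖
      = ∑ m ∈ (Finset.range n).map emb, (if m < s₀ + n then ‖f (m + 1) - f m‖ else 0) := by
    rw [Finset.sum_map]
    refine Finset.sum_congr rfl fun i hi => ?_
    rw [Finset.mem_range] at hi
    simp only [emb, Function.Embedding.coeFn_mk]
    rw [if_pos (by omega)]
    push_cast; ring_nf
  rw [hre]
  refine (Finset.sum_le_sum_of_subset_of_nonneg hsub fun m _ _ => by positivity).trans (Finset.sum_le_sum fun m _ => ?_)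
  by_cases h1 : m < s₀ + n
  · rw [if_pos h1, if_pos (by omega)]
  · rw [if_neg h1]; positivity

/-- `‖f s₀‖ ≤ ‖f k‖ + (variation on [a,b])` for `s₀, k ∈ [a, b]`. [folklore] -/
theorem norm_le_norm_add_variation (f : ℤ → E) {a b s₀ k : ℤ} (hs : s₀ ∈ Finset.Icc a b) (hk : k ∈ Finset.Icc a b) :
    ‖f s₀‖ ≤ ‖f k‖ + ∑ m ∈ Finset.Icc a b, (if m < b then ‖f (m + 1) - f m‖ else 0) := by
  rw [Finset.mem_Icc] at hs hk
  have h0 : ‖f s₀‖ ≤ ‖f k‖ + ‖f s₀ - f k‖ := by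
    have := norm_add_le (f k) (f s₀ - f k); rwa [add_sub_cancel] at this
  refine h0.trans (add_le_add le_rfl ?_)
  rcases le_total s₀ k with h | h
  · rw [norm_sub_rev]; exact norm_sub_le_variation_of_le f hs.1 h hk.2
  · exact norm_sub_le_variation_of_le f hk.1 h hs.2

/-- ★ **THE ONE-LINE LAYER ROW**: for `f : ℤ → E` on `[a,b]` (`a ≤ b`) and `t : ℕ`,
`Σ_{s∈[a,b], s<a+t ∨ b−t<s}‖f s‖² ≤ (4t∕(b+1−a))·Σ_{[a,b]}‖f s‖² + 4t(b+1−a)·Σ_{s∈[a,b], s<b}‖f(s+1) − f s‖²`. [folklore (discrete trace inequality)] -/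
theorem line_layer_sq_le (f : ℤ → E) {a b : ℤ} (hab : a ≤ b) (t : ℕ) :
    ∑ s ∈ (Finset.Icc a b).filter (fun s => s < a + t ∨ b - t < s), ‖f s‖ ^ 2
      ≤ (4 * t / ((b + 1 - a : ℤ) : ℝ)) * ∑ s ∈ Finset.Icc a b, ‖f s‖ ^ 2
        + 4 * t * ((b + 1 - a : ℤ) : ℝ) * ∑ s ∈ Finset.Icc a b, (if s < b then ‖f (s + 1) - f s‖ ^ 2 else 0) := by
  set n : ℝ := ((b + 1 - a : ℤ) : ℝ) with hn
  have hn0 : 0 < n := by rw [hn]; exact_mod_cast (by linarith : (0 : ℤ) < b + 1 - a)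
  have hcardI : ((Finset.Icc a b).card : ℝ) = n := by
    have h : ((Finset.Icc a b).card : ℤ) = b + 1 - a := Int.card_Icc_of_le a b (by linarith)
    rw [hn]; exact_mod_cast h
  set S := ∑ s ∈ Finset.Icc a b, ‖f s‖ ^ 2 with hS
  set V := ∑ m ∈ Finset.Icc a b, (if m < b then ‖f (m + 1) - f m‖ else 0) with hV
  set D := ∑ s ∈ Finset.Icc a b, (if s < b then ‖f (s + 1) - f s‖ ^ 2 else 0) with hD
  have hV0 : 0 ≤ V := Finset.sum_nonneg fun m _ => by positivity
  have hD0 : 0 ≤ D := Finset.sum_nonneg fun m _ => by positivity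
  have hS0 : 0 ≤ S := Finset.sum_nonneg fun m _ => by positivity
  -- Cauchy–Schwarz for the variation
  have hVD : V ^ 2 ≤ n * D := by
    have h := sq_sum_le_card_mul_sum_sq (s := Finset.Icc a b) (f := fun m => if m < b then ‖f (m + 1) - f m‖ else 0)
    rw [hcardI] at h
    refine h.trans (le_of_eq ?_)
    congr 1
    refine Finset.sum_congr rfl fun m _ => ?_
    split_ifs <;> simp
  -- pointwise bound, averaged over the base point
  have hpt : ∀ s₀ ∈ Finset.Icc a b, ‖f s₀‖ ^ 2 ≤ (2 / n) * S + 2 * n * D := by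
    intro s₀ hs₀
    have hk : ∀ k ∈ Finset.Icc a b, ‖f s₀‖ ^ 2 ≤ 2 * ‖f k‖ ^ 2 + 2 * V ^ 2 := by
      intro k hk
      have h := norm_le_norm_add_variation f hs₀ hk
      have h0 : 0 ≤ ‖f k‖ + V := by positivity
      nlinarith [pow_le_pow_left₀ (norm_nonneg _) h 2, sq_nonneg (‖f k‖ - V)]
    have hsum := Finset.sum_le_sum hk
    rw [Finset.sum_const, nsmul_eq_mul, hcardI, Finset.sum_add_distrib, ← Finset.mul_sum, Finset.sum_const, nsmul_eq_mul,
      hcardI] at hsum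
    -- hsum : n * ‖f s₀‖² ≤ 2 * S + n * (2 * V ^ 2)
    have h1 : ‖f s₀‖ ^ 2 ≤ (2 * S + n * (2 * V ^ 2)) / n := by
      rw [le_div_iff₀ hn0]; linarith
    have h2 : (2 * S + n * (2 * V ^ 2)) / n = (2 / n) * S + 2 * V ^ 2 := by field_simp
    rw [h2] at h1
    nlinarith
  -- the end set has at most `2t` points
  have hcard : (((Finset.Icc a b).filter (fun s => s < a + t ∨ b - t < s)).card : ℝ) ≤ 2 * t := by
    have hsub : (Finset.Icc a b).filter (fun s => s < a + t ∨ b - t < s) ⊆ Finset.Icc a (a + t - 1) ∪ Finset.Icc (b - t + 1) b := by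
      intro s hs
      rw [Finset.mem_filter, Finset.mem_Icc] at hs
      rw [Finset.mem_union, Finset.mem_Icc, Finset.mem_Icc]
      omega
    have h1 := Finset.card_le_card hsub
    have h2 := Finset.card_union_le (Finset.Icc a (a + t - 1)) (Finset.Icc (b - t + 1) b)
    rw [Int.card_Icc, Int.card_Icc] at h2
    have h3 : (a + ↑t - 1 + 1 - a).toNat = t := by simp
    have h4 : (b + 1 - (b - ↑t + 1)).toNat = t := by ring_nf; simp
    rw [h3, h4] at h2
    have h5 : (((Finset.Icc a b).filter (fun s => s < a + t ∨ b - t < s)).card : ℝ) ≤ ((t + t : ℕ) : ℝ) := by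
      exact_mod_cast h1.trans h2
    refine h5.trans (le_of_eq ?_); push_cast; ring
  calc ∑ s ∈ (Finset.Icc a b).filter (fun s => s < a + t ∨ b - t < s), ‖f s‖ ^ 2
      ≤ ∑ s ∈ (Finset.Icc a b).filter (fun s => s < a + t ∨ b - t < s), ((2 / n) * S + 2 * n * D) :=
        Finset.sum_le_sum fun s hs => hpt s (Finset.mem_filter.1 hs).1
    _ = (((Finset.Icc a b).filter (fun s => s < a + t ∨ b - t < s)).card : ℝ) * ((2 / n) * S + 2 * n * D) := by
        rw [Finset.sum_const, nsmul_eq_mul]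
    _ ≤ (2 * t) * ((2 / n) * S + 2 * n * D) := mul_le_mul_of_nonneg_right hcard (by positivity)
    _ = (4 * t / n) * S + 4 * t * n * D := by ring

/-! ## §2 The box, flat differences -/

/-- For `x ∈ Q_R(z)`: `x + e_i ∈ Q_R(z) ↔ x i < z i + R`. [folklore] -/
theorem add_unitVec_mem_box_iff {z x : Zd d} {R : ℤ} (hx : x ∈ box z R) (i : Fin d) :
    x + unitVec i ∈ box z R ↔ x i < z i + R := by
  rw [mem_box] at hx ⊢
  constructor
  · intro h
    have := h i
    simp only [Pi.add_apply, unitVec, Pi.single_eq_same] at this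
    rw [abs_le] at this; omega
  · intro hi j
    have hj := hx j
    by_cases hji : j = i
    · subst hji
      simp only [Pi.add_apply, unitVec, Pi.single_eq_same]
      rw [abs_le] at hj ⊢; omega
    · simp only [Pi.add_apply, unitVec, Pi.single_apply, if_neg hji, add_zero]
      exact hj

/-- A point of `Q_R(z)` outside `Q_{R−t}(z)` is within `t` of a face: `∃ i, x i < z i − R + t ∨ z i + R − t < x i`. [folklore] -/
theorem exists_near_face {z x : Zd d} {R : ℤ} {t : ℕ} (hx' : x ∉ box z (R - t)) :
    ∃ i, x i < z i - R + t ∨ z i + R - t < x i := by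
  rw [mem_box, not_forall] at hx'
  obtain ⟨i, hi⟩ := hx'
  refine ⟨i, ?_⟩
  rw [not_le, lt_abs] at hi
  omega

/-- ★ **THE LAYER ROW ON A BOX (flat)**: for `0 ≤ R`, `t : ℕ`, `w : ℤᵈ → E`,
`Σ_{Q_R∖Q_{R−t}}‖w‖² ≤ (4dt∕(2R+1))·Σ_{Q_R}‖w‖² + 4t(2R+1)·Σ_{Q_R}Σ_i [x+e_i ∈ Q_R]·‖w(x+e_i) − w x‖²`. [folklore (discrete trace inequality)] -/
theorem sum_layer_sq_le {z : Zd d} {R : ℤ} (hR : 0 ≤ R) (t : ℕ) (w : Zd d → E) :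
    ∑ x ∈ box z R \ box z (R - t), ‖w x‖ ^ 2
      ≤ (4 * d * t / (2 * (R : ℝ) + 1)) * ∑ x ∈ box z R, ‖w x‖ ^ 2
        + 4 * t * (2 * (R : ℝ) + 1) * ∑ x ∈ box z R, ∑ i, (if x + unitVec i ∈ box z R then ‖w (x + unitVec i) - w x‖ ^ 2 else 0) := by
  classical
  -- union bound over the faces
  have hU : ∑ x ∈ box z R \ box z (R - t), ‖w x‖ ^ 2
      ≤ ∑ i : Fin d, ∑ x ∈ box z R, (if x i < z i - R + t ∨ z i + R - t < x i then ‖w x‖ ^ 2 else 0) := by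
    rw [Finset.sum_comm]
    calc ∑ x ∈ box z R \ box z (R - t), ‖w x‖ ^ 2
        ≤ ∑ x ∈ box z R \ box z (R - t), ∑ i : Fin d, (if x i < z i - R + t ∨ z i + R - t < x i then ‖w x‖ ^ 2 else 0) := by
          refine Finset.sum_le_sum fun x hx => ?_
          obtain ⟨i, hi⟩ := exists_near_face (Finset.mem_sdiff.1 hx).2
          refine le_trans (le_of_eq ?_)
            (Finset.single_le_sum (f := fun j : Fin d => if x j < z j - R + t ∨ z j + R - t < x j then ‖w x‖ ^ 2 else 0)
              (fun j _ => by positivity) (Finset.mem_univ i))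
          simp only [if_pos hi]
      _ ≤ ∑ x ∈ box z R, ∑ i : Fin d, (if x i < z i - R + t ∨ z i + R - t < x i then ‖w x‖ ^ 2 else 0) :=
          Finset.sum_le_sum_of_subset_of_nonneg Finset.sdiff_subset fun x _ _ =>
            Finset.sum_nonneg fun i _ => by positivity
  refine hU.trans ?_
  -- per direction: Fubini + the one-line row
  have hdir : ∀ i : Fin d, ∑ x ∈ box z R, (if x i < z i - R + t ∨ z i + R - t < x i then ‖w x‖ ^ 2 else 0)
      ≤ (4 * t / (2 * (R : ℝ) + 1)) * ∑ x ∈ box z R, ‖w x‖ ^ 2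
        + 4 * t * (2 * (R : ℝ) + 1) * ∑ x ∈ box z R, (if x + unitVec i ∈ box z R then ‖w (x + unitVec i) - w x‖ ^ 2 else 0) := by
    intro i
    have hn : (((z i + R) + 1 - (z i - R) : ℤ) : ℝ) = 2 * (R : ℝ) + 1 := by push_cast; ring
    set Sl := Fintype.piFinset (Function.update (fun i => Finset.Icc (z i - R) (z i + R)) i {z i}) with hSl
    set I := Finset.Icc (z i - R) (z i + R) with hI
    rw [sum_box_eq_sum_update z R i (z i) (fun x => if x i < z i - R + t ∨ z i + R - t < x i then ‖w x‖ ^ 2 else 0),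
      sum_box_eq_sum_update z R i (z i) (fun x => ‖w x‖ ^ 2),
      sum_box_eq_sum_update z R i (z i) (fun x => if x + unitVec i ∈ box z R then ‖w (x + unitVec i) - w x‖ ^ 2 else 0)]
    have e1 : ∑ s ∈ I, ∑ y ∈ Sl, (if (Function.update y i s) i < z i - R + t ∨ z i + R - t < (Function.update y i s) i
          then ‖w (Function.update y i s)‖ ^ 2 else 0)
        = ∑ y ∈ Sl, ∑ s ∈ I, (if s < z i - R + t ∨ z i + R - t < s then ‖w (Function.update y i s)‖ ^ 2 else 0) := by
      rw [Finset.sum_comm]; simp only [Function.update_self]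
    have e2 : ∑ s ∈ I, ∑ y ∈ Sl, ‖w (Function.update y i s)‖ ^ 2 = ∑ y ∈ Sl, ∑ s ∈ I, ‖w (Function.update y i s)‖ ^ 2 :=
      Finset.sum_comm
    have e3 : ∑ s ∈ I, ∑ y ∈ Sl, (if Function.update y i s + unitVec i ∈ box z R
          then ‖w (Function.update y i s + unitVec i) - w (Function.update y i s)‖ ^ 2 else 0)
        = ∑ y ∈ Sl, ∑ s ∈ I, (if s < z i + R then ‖w (Function.update y i (s + 1)) - w (Function.update y i s)‖ ^ 2 else 0) := by
      rw [Finset.sum_comm]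
      refine Finset.sum_congr rfl fun y hy => Finset.sum_congr rfl fun s hs => ?_
      have hmem : Function.update y i s ∈ box z R := by
        rw [Fintype.mem_piFinset] at hy
        rw [mem_box]; intro j
        by_cases hji : j = i
        · subst hji; rw [Function.update_self]; rw [hI, Finset.mem_Icc] at hs; rw [abs_le]; omega
        · rw [Function.update_of_ne hji]
          have := hy j; rw [Function.update_of_ne hji, Finset.mem_Icc] at this; rw [abs_le]; omega
      have hstep : Function.update y i s + unitVec i = Function.update y i (s + 1) := by
        ext j
        by_cases hji : j = i
        · subst hji; simp [unitVec]
        · simp [unitVec, hji]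
      rw [hstep]
      have hiff : Function.update y i (s + 1) ∈ box z R ↔ s < z i + R := by
        rw [← hstep, add_unitVec_mem_box_iff hmem, Function.update_self]
      by_cases hc : s < z i + R
      · rw [if_pos (hiff.2 hc), if_pos hc]
      · rw [if_neg (fun h => hc (hiff.1 h)), if_neg hc]
    rw [e1, e2, e3, Finset.mul_sum, Finset.mul_sum, ← Finset.sum_add_distrib]
    refine Finset.sum_le_sum fun y _ => ?_
    have hline := line_layer_sq_le (f := fun s => w (Function.update y i s)) (a := z i - R) (b := z i + R) (by linarith) t
    rw [hn, Finset.sum_filter] at hline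
    exact hline
  calc ∑ i : Fin d, ∑ x ∈ box z R, (if x i < z i - R + t ∨ z i + R - t < x i then ‖w x‖ ^ 2 else 0)
      ≤ ∑ i : Fin d, ((4 * t / (2 * (R : ℝ) + 1)) * ∑ x ∈ box z R, ‖w x‖ ^ 2
          + 4 * t * (2 * (R : ℝ) + 1) * ∑ x ∈ box z R, (if x + unitVec i ∈ box z R then ‖w (x + unitVec i) - w x‖ ^ 2 else 0)) :=
        Finset.sum_le_sum fun i _ => hdir i
    _ = _ := by
        rw [Finset.sum_add_distrib, Finset.sum_const, Finset.card_univ, Fintype.card_fin, nsmul_eq_mul, ← Finset.mul_sum,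
          Finset.sum_comm]
        ring

/-! ## §3 Covariant differences -/

/-- ★★ **THE LAYER ROW, COVARIANT SMALL-BOND FORM**: `T` unitary (`U1`) with `‖T y μ − 1‖ ≤ β` on the bonds of `Q_R(z)`, `w : ℤᵈ → M_N(ℂ)`:
`Σ_{Q_R∖Q_{R−t}}‖w‖² ≤ (4dt∕(2R+1) + 32dt(2R+1)β²)·Σ_{Q_R}‖w‖² + 8t(2R+1)·Σ_{Q_R}Σ_μ[x+e_μ∈Q_R]‖R(T x μ)w(x+e_μ) − w x‖²`.
[folklore (discrete trace inequality + small-bond perturbation)] -/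
theorem sum_layer_sq_le_cov [NeZero N] {z : Zd d} {R : ℤ} (hR : 0 ≤ R) (t : ℕ) {β : ℝ}
    (T : Zd d → Fin d → (Matrix (Fin N) (Fin N) ℂ)ˣ) (hT : ∀ y μ, T y μ ∈ U1 (Matrix (Fin N) (Fin N) ℂ))
    (hTβ : ∀ (y : Zd d) (μ : Fin d), y ∈ box z R → y + unitVec μ ∈ box z R → ‖(T y μ : Matrix (Fin N) (Fin N) ℂ) - 1‖ ≤ β)
    (w : Zd d → Matrix (Fin N) (Fin N) ℂ) :
    ∑ x ∈ box z R \ box z (R - t), ‖w x‖ ^ 2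
      ≤ (4 * d * t / (2 * (R : ℝ) + 1) + 32 * d * t * (2 * (R : ℝ) + 1) * β ^ 2) * ∑ x ∈ box z R, ‖w x‖ ^ 2
        + 8 * t * (2 * (R : ℝ) + 1) *
            ∑ x ∈ box z R, ∑ μ, (if x + unitVec μ ∈ box z R then ‖conjR (T x μ) (w (x + unitVec μ)) - w x‖ ^ 2 else 0) := by
  classical
  have hflat := sum_layer_sq_le (E := Matrix (Fin N) (Fin N) ℂ) (z := z) hR t w
  -- termwise: flat difference ≤ covariant difference + transport defect
  have ht : ∀ x ∈ box z R, ∀ μ : Fin d,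
      (if x + unitVec μ ∈ box z R then ‖w (x + unitVec μ) - w x‖ ^ 2 else (0 : ℝ))
        ≤ 2 * (if x + unitVec μ ∈ box z R then ‖conjR (T x μ) (w (x + unitVec μ)) - w x‖ ^ 2 else 0)
          + 8 * β ^ 2 * (if x + unitVec μ ∈ box z R then ‖w (x + unitVec μ)‖ ^ 2 else 0) := by
    intro x hx μ
    split_ifs with hxμ
    · have h1 := norm_conjR_sub_self_le (hT x μ) (w (x + unitVec μ))
      have h2 := hTβ x μ hx hxμ
      have hid : w (x + unitVec μ) - w x
          = (conjR (T x μ) (w (x + unitVec μ)) - w x) - (conjR (T x μ) (w (x + unitVec μ)) - w (x + unitVec μ)) := by abel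
      have h3 : ‖w (x + unitVec μ) - w x‖
          ≤ ‖conjR (T x μ) (w (x + unitVec μ)) - w x‖ + ‖conjR (T x μ) (w (x + unitVec μ)) - w (x + unitVec μ)‖ := by
        rw [hid]; exact norm_sub_le _ _
      have h4 : ‖conjR (T x μ) (w (x + unitVec μ)) - w (x + unitVec μ)‖ ≤ 2 * β * ‖w (x + unitVec μ)‖ :=
        h1.trans (mul_le_mul_of_nonneg_right (mul_le_mul_of_nonneg_left h2 (by norm_num)) (norm_nonneg _))
      have h0 : 0 ≤ ‖conjR (T x μ) (w (x + unitVec μ)) - w x‖ := norm_nonneg _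
      have h0' : 0 ≤ 2 * β * ‖w (x + unitVec μ)‖ := le_trans (norm_nonneg _) h4
      nlinarith [pow_le_pow_left₀ (norm_nonneg _) (h3.trans (add_le_add le_rfl h4)) 2,
        sq_nonneg (‖conjR (T x μ) (w (x + unitVec μ)) - w x‖ - 2 * β * ‖w (x + unitVec μ)‖)]
    · simp
  -- the shifted mass
  have hshift : ∀ μ : Fin d, ∑ x ∈ box z R, (if x + unitVec μ ∈ box z R then ‖w (x + unitVec μ)‖ ^ 2 else (0 : ℝ))
      ≤ ∑ x ∈ box z R, ‖w x‖ ^ 2 := by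
    intro μ
    have h := sum_box_shift_le (z := z) (R := R) (H := fun y => if y ∈ box z R then ‖w y‖ ^ 2 else 0)
      (fun y => by positivity) (fun y hy => if_neg hy) (unitVec μ)
    refine (le_of_eq ?_).trans (h.trans (le_of_eq ?_))
    · rfl
    · exact Finset.sum_congr rfl fun x hx => if_pos hx
  have hsum : ∑ x ∈ box z R, ∑ μ, (if x + unitVec μ ∈ box z R then ‖w (x + unitVec μ) - w x‖ ^ 2 else (0 : ℝ))
      ≤ 2 * ∑ x ∈ box z R, ∑ μ, (if x + unitVec μ ∈ box z R then ‖conjR (T x μ) (w (x + unitVec μ)) - w x‖ ^ 2 else 0)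
        + 8 * β ^ 2 * (d * ∑ x ∈ box z R, ‖w x‖ ^ 2) := by
    calc ∑ x ∈ box z R, ∑ μ, (if x + unitVec μ ∈ box z R then ‖w (x + unitVec μ) - w x‖ ^ 2 else (0 : ℝ))
        ≤ ∑ x ∈ box z R, ∑ μ, (2 * (if x + unitVec μ ∈ box z R then ‖conjR (T x μ) (w (x + unitVec μ)) - w x‖ ^ 2 else 0)
            + 8 * β ^ 2 * (if x + unitVec μ ∈ box z R then ‖w (x + unitVec μ)‖ ^ 2 else 0)) :=
          Finset.sum_le_sum fun x hx => Finset.sum_le_sum fun μ _ => ht x hx μ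
      _ = 2 * ∑ x ∈ box z R, ∑ μ, (if x + unitVec μ ∈ box z R then ‖conjR (T x μ) (w (x + unitVec μ)) - w x‖ ^ 2 else 0)
            + 8 * β ^ 2 * ∑ x ∈ box z R, ∑ μ, (if x + unitVec μ ∈ box z R then ‖w (x + unitVec μ)‖ ^ 2 else 0) := by
          simp only [Finset.sum_add_distrib, ← Finset.mul_sum]
      _ ≤ _ := by
          refine add_le_add le_rfl (mul_le_mul_of_nonneg_left ?_ (by positivity))
          calc ∑ x ∈ box z R, ∑ μ : Fin d, (if x + unitVec μ ∈ box z R then ‖w (x + unitVec μ)‖ ^ 2 else (0 : ℝ))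
              = ∑ μ : Fin d, ∑ x ∈ box z R, (if x + unitVec μ ∈ box z R then ‖w (x + unitVec μ)‖ ^ 2 else (0 : ℝ)) :=
                Finset.sum_comm
            _ ≤ ∑ μ : Fin d, ∑ x ∈ box z R, ‖w x‖ ^ 2 := Finset.sum_le_sum fun μ _ => hshift μ
            _ = d * ∑ x ∈ box z R, ‖w x‖ ^ 2 := by rw [Finset.sum_const, Finset.card_univ, Fintype.card_fin, nsmul_eq_mul]
  have hR0 : (0 : ℝ) ≤ R := by exact_mod_cast hR
  have hR1 : (0 : ℝ) ≤ 2 * (R : ℝ) + 1 := by linarith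
  have hc : (0 : ℝ) ≤ 4 * t * (2 * (R : ℝ) + 1) := by positivity
  have := mul_le_mul_of_nonneg_left hsum hc
  have e : (4 * d * t / (2 * (R : ℝ) + 1) + 32 * d * t * (2 * (R : ℝ) + 1) * β ^ 2) * ∑ x ∈ box z R, ‖w x‖ ^ 2
        + 8 * t * (2 * (R : ℝ) + 1) *
            ∑ x ∈ box z R, ∑ μ, (if x + unitVec μ ∈ box z R then ‖conjR (T x μ) (w (x + unitVec μ)) - w x‖ ^ 2 else 0)
      = (4 * d * t / (2 * (R : ℝ) + 1)) * ∑ x ∈ box z R, ‖w x‖ ^ 2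
        + 4 * t * (2 * (R : ℝ) + 1) *
          (2 * ∑ x ∈ box z R, ∑ μ, (if x + unitVec μ ∈ box z R then ‖conjR (T x μ) (w (x + unitVec μ)) - w x‖ ^ 2 else 0)
            + 8 * β ^ 2 * (d * ∑ x ∈ box z R, ‖w x‖ ^ 2)) := by ring
  rw [e]
  linarith

/-- ★★ **THE LAYER ROW FROM THE PLAQUETTE BOUND** (for the local potential `φ` of ✓`boxLocalPotential`): `V` unitary with `PlaqSmall V (z−R) (z+R) α`;
in the box axial gauge the bonds are `2dRα`-small, so for every `φ : ℤᵈ → M_N(ℂ)` and `t : ℕ`,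
`Σ_{Q_R∖Q_{R−t}}‖φ‖² ≤ (4dt∕(2R+1) + 32dt(2R+1)(2dRα)²)·Σ_{Q_R}‖φ‖² + 8t(2R+1)·Σ_{Q_R}Σ_μ[x+e_μ∈Q_R]‖R(V x μ)φ(x+e_μ) − φ x‖²`.
[cite: Balaban1985Averaging, pp.24-25; folklore (discrete trace inequality)] -/
theorem sum_layer_sq_le_plaq [NeZero N] {z : Zd d} {R : ℤ} (hR : 0 ≤ R) (t : ℕ) {α : ℝ} (hα : 0 ≤ α)
    (V : Zd d → Fin d → (Matrix (Fin N) (Fin N) ℂ)ˣ) (hV : ∀ y μ, V y μ ∈ unitaryUnits (Matrix (Fin N) (Fin N) ℂ))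
    (hP : B8Lemma1NonAbelian.PlaqSmall V (fun i => z i - R) (fun i => z i + R) α)
    (φ : Zd d → Matrix (Fin N) (Fin N) ℂ) :
    ∑ x ∈ box z R \ box z (R - t), ‖φ x‖ ^ 2
      ≤ (4 * d * t / (2 * (R : ℝ) + 1) + 32 * d * t * (2 * (R : ℝ) + 1) * (2 * d * R * α) ^ 2) * ∑ x ∈ box z R, ‖φ x‖ ^ 2
        + 8 * t * (2 * (R : ℝ) + 1) *
            ∑ x ∈ box z R, ∑ μ, (if x + unitVec μ ∈ box z R then ‖conjR (V x μ) (φ (x + unitVec μ)) - φ x‖ ^ 2 else 0) := by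
  classical
  set u : Zd d → (Matrix (Fin N) (Fin N) ℂ)ˣ := axialFn V (fun i => z i - R) with hu_def
  have hV1 : ∀ x μ, V x μ ∈ U1 (Matrix (Fin N) (Fin N) ℂ) := fun x μ => mem_U1_of_mem_unitaryUnits (hV x μ)
  have hu1 : ∀ x, u x ∈ U1 (Matrix (Fin N) (Fin N) ℂ) := fun x => mem_U1_of_mem_unitaryUnits (B7Prop2Explicit.hol_mem_of hV _ _)
  have h := sum_layer_sq_le_cov (N := N) hR t (β := 2 * d * R * α) (gaugeAct u V) (fun x μ => gaugeAct_mem hV1 hu1 x μ)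
    (fun x μ hx hxμ => Prop7LatticeBoxFriedrichsCurved.norm_axial_sub_one_le_of_plaqSmall hα V hV1 hP x μ hx hxμ)
    (fun x => conjR (u x) (φ x))
  have e1 : ∀ x, ‖conjR (u x) (φ x)‖ = ‖φ x‖ := fun x => norm_conjR (hu1 x) (φ x)
  have e2 : ∀ (x : Zd d) (μ : Fin d),
      ‖conjR (gaugeAct u V x μ) (conjR (u (x + unitVec μ)) (φ (x + unitVec μ))) - conjR (u x) (φ x)‖
        = ‖conjR (V x μ) (φ (x + unitVec μ)) - φ x‖ := by
    intro x μ
    rw [Prop7LatticeBoxFriedrichsCurved.conjR_gaugeAct_conjR, ← conjR_sub, norm_conjR (hu1 x)]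
  simp only [e1, e2] at h
  exact h

end Summit.QuantumFields.YangMills.Theorems.Prop7LatticeBoxLayerTrace
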